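import Mathlib
import Summits.CriticalPhenomena.CardyFormulaZ2.Theorems.CardyMagicRigidityNestingRigidityBigLoopsExpMomentMeetBall
import Summits.CriticalPhenomena.CardyFormulaZ2.Theorems.CardyMagicRigidityNestingRigidityUVExpMomentsAssembly
import HarnessLib

/-!
# Crux `NestingRigidity`, line `positive-cone-weight-doubling`: the UNCENTRED multi-scale bound for
# sums of big-loop counts with geometric weights, both lattices (engine of Ξ₂)

Crux `Summit.CriticalPhenomena.CardyFormulaZ2.Theses.CardyMagicRigidity.NestingRigidity`
(stmt-CriticalPhenomena-4835), line `positive-cone-weight-doubling`, registered helper Ξ₂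
`uvFarBiteSq_expMoment_latticeEnsembles` (`E_δ exp(a Σ_{far} (φ_u − ψ_u)²) ≤ C`, all `a > 0`).  A
far loop of diameter `d` bites at most `min(1, d⁴/ρ⁴)` squared fraction of the disc of radius `ρ`
(`ρ = r` for the disc part, `ρ = 1` for the ring part), and `min(1, t⁴) ≤ Σ_k 16^{-k}·1[t ≥ 2^{-k-1}]`
(dyadic classes of the diameter), so the statistic is dominated by the WEIGHTED SUM OF CUMULATIVE
BIG-LOOP COUNTS `T_n = Σ_{k<n} 16^{-k} N_k`, `N_k = #{u ∈ X_δ : trace u ∩ B̄(x₀, R₀ρ) ≠ ∅,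
diam ≥ ρ/2^{k+1}}`.  This file proves (no cited fact, no definition, no independence needed):

* §1 covers of a window of any centre by `B ≤ 81 (L/ℓ)²` closed `ℓ`-discs
  (`BigLoops.exists_cover_closedBall`, recentred) and the union bound for the meeting counts;
* §2 ONE SCALE (`expMoment_oneScale_le`): `E_δ exp((2a/8^k) N_k) ≤ C₀` uniformly in `k`, the centre,
  the unit `ρ > 0` and the mesh — generalised Hölder over the `B_k ≤ 81 R₀² 4^k` discs of the cover
  with equal weights (`expMoment_sum_le_prod_latticeEnsembles`): the order per disc
  `(2a/8^k) B_k ≤ 162 a R₀²` stays BOUNDED, and K6 at all centres and scales with no mesh constraint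
  (`expMoment_ncard_bigLoops_meeting_le_ball`) bounds every factor by the same `C₀`;
* §3 ACROSS SCALES (registered anchor `expMoment_weightedBigLoops_le_latticeEnsembles`): with the
  weights `w_k = 2^{-k-1}` (`(a/16^k)/w_k = 2a/8^k`), `E_δ exp(a T_n) ≤ max(1, C₀)` uniformly in
  `n` (`expMoment_scaleSum_le_latticeEnsembles`).
-/

noncomputable section

open MeasureTheory Set Filter Metric
open scoped Real Topology BigOperators

namespace Summit.CriticalPhenomena.CardyFormulaZ2.Cruxes.NestingRigidity.PositiveConeWeightDoubling

open Literature.Probability.RandomPlanarGeometry Literature.Probability.Percolation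
  Literature.Probability.LatticeModels
open Summit.CriticalPhenomena.CardyFormulaZ2.Cruxes.NestingRigidity.RingCloudTomography

namespace UVFarBiteSq

/-! ## §1 Covers of a window of any centre; the union bound for meeting counts -/

/-- **Cover of a closed disc of any centre**: for `0 < ℓ ≤ L`, `B̄(x₀, L)` is covered by `B` closed
`ℓ`-discs with `1 ≤ B ≤ 81 (L/ℓ)²` (the grid cover `BigLoops.exists_cover_closedBall`, translated). -/
theorem exists_cover_closedBall_centre (x₀ : ℂ) {ℓ L : ℝ} (hℓ : 0 < ℓ) (hℓL : ℓ ≤ L) :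
    ∃ (B : ℕ) (c : Fin B → ℂ), 0 < B ∧ (B : ℝ) ≤ 81 * (L / ℓ) ^ 2 ∧
      ∀ z ∈ closedBall x₀ L, ∃ i, z ∈ closedBall (c i) ℓ := by
  obtain ⟨S, hScard, hcover⟩ := BigLoops.exists_cover_closedBall hℓ hℓL
  set c : Fin S.card → ℂ := fun i ↦ x₀ + (ℓ : ℂ) * ((S.equivFin.symm i : S) : ℂ) with hc
  refine ⟨S.card, c, ?_, hScard, fun z hz ↦ ?_⟩
  · rw [Finset.card_pos]
    have h0 : (0 : ℂ) ∈ closedBall (0 : ℂ) L := mem_closedBall_self (hℓ.le.trans hℓL)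
    obtain ⟨y, hy, -⟩ := mem_iUnion₂.1 (hcover h0)
    exact ⟨y, hy⟩
  · have hz' : z - x₀ ∈ closedBall (0 : ℂ) L := by
      rwa [mem_closedBall, dist_zero_right, ← dist_eq_norm]
    obtain ⟨y, hy, hzy⟩ := mem_iUnion₂.1 (hcover hz')
    refine ⟨S.equivFin ⟨y, hy⟩, ?_⟩
    rw [hc]
    dsimp only
    rw [Equiv.symm_apply_apply, mem_closedBall, dist_eq_norm]
    rw [mem_closedBall, dist_eq_norm] at hzy
    rwa [show z - (x₀ + (ℓ : ℂ) * (y : ℂ)) = z - x₀ - (ℓ : ℂ) * y by ring]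

/-- **Union bound**: the number of big loops meeting a window is at most the sum over a cover of the
numbers of big loops meeting the discs of the cover (finite families). -/
theorem ncard_meeting_le_sum_cover {B : ℕ} (c : Fin B → ℂ) {x₀ : ℂ} {ℓ L : ℝ}
    (hcov : ∀ z ∈ closedBall x₀ L, ∃ i, z ∈ closedBall (c i) ℓ) (Lps : Set (UnbasedLoop ℂ)) (η : ℝ)
    (hfin : ∀ i, {u ∈ Lps | (u.range ∩ closedBall (c i) ℓ).Nonempty ∧ η ≤ diam u.range}.Finite) :
    {u ∈ Lps | (u.range ∩ closedBall x₀ L).Nonempty ∧ η ≤ diam u.range}.ncard ≤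
      ∑ i, {u ∈ Lps | (u.range ∩ closedBall (c i) ℓ).Nonempty ∧ η ≤ diam u.range}.ncard := by
  have hsub : {u ∈ Lps | (u.range ∩ closedBall x₀ L).Nonempty ∧ η ≤ diam u.range} ⊆
      ⋃ i ∈ (Finset.univ : Finset (Fin B)),
        {u ∈ Lps | (u.range ∩ closedBall (c i) ℓ).Nonempty ∧ η ≤ diam u.range} := by
    rintro u ⟨hu, ⟨z, hz, hzL⟩, hd⟩
    obtain ⟨i, hi⟩ := hcov z hzL
    exact mem_iUnion₂.2 ⟨i, Finset.mem_univ _, hu, ⟨z, hz, hi⟩, hd⟩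
  have hUfin : (⋃ i ∈ (Finset.univ : Finset (Fin B)),
      {u ∈ Lps | (u.range ∩ closedBall (c i) ℓ).Nonempty ∧ η ≤ diam u.range}).Finite :=
    Set.Finite.biUnion (Finset.finite_toSet _) fun i _ ↦ hfin i
  exact (ncard_le_ncard hsub hUfin).trans (Finset.set_ncard_biUnion_le _ _)

/-! ## §2 One scale: Hölder over the discs of the cover, bounded order per disc -/

/-- **One scale of the uncentred multi-scale bound, both lattices.**  For `E ∈ latticeEnsembles`,
`a ≥ 0` and `R₀ ≥ 1` there is `C₀ > 0` such that for every centre `x₀`, unit `ρ > 0`, mesh `δ > 0`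
and scale `k`, the cumulative count `N_k = #{u ∈ X_δ : trace u ∩ B̄(x₀, R₀ρ) ≠ ∅, diam ≥ ρ/2^{k+1}}`
has `E_δ exp((2a/8^k) N_k) ≤ C₀` (integrability included): `N_k ≤ Σ_i N_{k,i}` over a cover by
`B_k ≤ 81 R₀² 4^k` discs of radius `ρ/2^k`, generalised Hölder with equal weights `1/B_k`, and the
order per disc `(2a/8^k) B_k ≤ 162 a R₀²` is bounded, so that K6 at all centres and scales
(`expMoment_ncard_bigLoops_meeting_le_ball`, window `1`, diameter `1/2`, scale `ρ/2^k`) bounds every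
factor by the same constant. -/
theorem expMoment_oneScale_le : ∀ E ∈ latticeEnsembles, ∀ (a R₀ : ℝ), 0 ≤ a → 1 ≤ R₀ →
    ∃ C₀ : ℝ, 0 < C₀ ∧ ∀ (x₀ : ℂ) (ρ δ : ℝ), 0 < ρ → 0 < δ → ∀ k : ℕ,
      Integrable (fun ω ↦ Real.exp (2 * a / 8 ^ k * ({u ∈ (E.X δ ω).loops |
        (u.range ∩ closedBall x₀ (R₀ * ρ)).Nonempty ∧ ρ / 2 ^ (k + 1) ≤ diam u.range}.ncard : ℝ))) E.P ∧
      ∫ ω, Real.exp (2 * a / 8 ^ k * ({u ∈ (E.X δ ω).loops |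
        (u.range ∩ closedBall x₀ (R₀ * ρ)).Nonempty ∧ ρ / 2 ^ (k + 1) ≤ diam u.range}.ncard : ℝ)) ∂E.P ≤ C₀ := by
  intro E hE a R₀ ha hR₀
  haveI := isProbabilityMeasure_of_mem hE
  obtain ⟨C₀, hC₀, hK6⟩ := expMoment_ncard_bigLoops_meeting_le_ball E hE (162 * a * R₀ ^ 2) 1 (1 / 2)
    (by norm_num) (by norm_num)
  refine ⟨C₀, hC₀, fun x₀ ρ δ hρ hδ k ↦ ?_⟩
  -- the scale and the cover
  set ℓ : ℝ := ρ / 2 ^ k with hℓ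
  have hℓ0 : 0 < ℓ := by positivity
  have h2k : (1 : ℝ) ≤ 2 ^ k := one_le_pow₀ (by norm_num)
  have hℓρ : ℓ ≤ ρ := by rw [hℓ]; exact div_le_self hρ.le h2k
  have hℓL : ℓ ≤ R₀ * ρ := hℓρ.trans (le_mul_of_one_le_left hρ.le hR₀)
  obtain ⟨B, c, hB, hBle, hcov⟩ := exists_cover_closedBall_centre x₀ hℓ0 hℓL
  have hBR : (B : ℝ) ≤ 81 * R₀ ^ 2 * 4 ^ k := by
    refine hBle.trans (le_of_eq ?_)
    rw [hℓ, show (4 : ℝ) ^ k = (2 ^ k) ^ 2 by rw [← pow_mul, mul_comm, pow_mul]; norm_num]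
    field_simp
  have hB0 : (0 : ℝ) < B := by exact_mod_cast hB
  -- the disc counts, in the syntactic form of K6
  have hthr : ρ / 2 ^ (k + 1) = ℓ * (1 / 2) := by rw [hℓ, pow_succ]; ring
  have hball : ∀ i, closedBall (c i) ℓ = closedBall (c i) (ℓ * 1) := fun i ↦ by rw [mul_one]
  set N : Fin B → E.Ω → ℝ := fun i ω ↦ ({u ∈ (E.X δ ω).loops |
    (u.range ∩ closedBall (c i) (ℓ * 1)).Nonempty ∧ ℓ * (1 / 2) ≤ diam u.range}.ncard : ℝ) with hN
  have hNm : ∀ i, Measurable (N i) := fun i ↦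
    measurable_from_nat.comp (BigLoops.measurable_ncard_loops_sep E hE δ _)
  have hN0 : ∀ i ω, 0 ≤ N i ω := fun i ω ↦ Nat.cast_nonneg _
  have hNint : ∀ (i) (b : ℝ), Integrable (fun ω ↦ Real.exp (b * N i ω)) E.P := fun i b ↦
    BigLoopsMeetBall.integrable_exp_mul_ncard_loops_meeting E hE hδ (c i) (ℓ * 1) b _ fun _ hu ↦ hu.1
  have hK6i : ∀ i, ∫ ω, Real.exp (162 * a * R₀ ^ 2 * N i ω) ∂E.P ≤ C₀ := fun i ↦
    (hK6 (c i) ℓ δ hℓ0 hδ).2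
  -- the window count is dominated by the sum of the disc counts
  have hfin : ∀ ω i, {u ∈ (E.X δ ω).loops |
      (u.range ∩ closedBall (c i) (ℓ * 1)).Nonempty ∧ ℓ * (1 / 2) ≤ diam u.range}.Finite := by
    intro ω i
    obtain ⟨M, hM⟩ := BigLoopsMeet.exists_ncard_loops_sep_meeting_le E hE hδ (‖c i‖ + ℓ * 1)
    refine (hM _ (fun u hu ↦ ?_) ω).1
    obtain ⟨z, hz, hz'⟩ := hu.1
    refine ⟨z, hz, ?_⟩
    rw [mem_closedBall, dist_zero_right]
    rw [mem_closedBall, dist_eq_norm] at hz'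
    calc ‖z‖ = ‖z - c i + c i‖ := by rw [sub_add_cancel]
      _ ≤ ‖z - c i‖ + ‖c i‖ := norm_add_le _ _
      _ ≤ ‖c i‖ + ℓ * 1 := by linarith
  have hdom : ∀ ω, ({u ∈ (E.X δ ω).loops |
      (u.range ∩ closedBall x₀ (R₀ * ρ)).Nonempty ∧ ρ / 2 ^ (k + 1) ≤ diam u.range}.ncard : ℝ) ≤
      ∑ i, N i ω := fun ω ↦ by
    rw [hN]
    dsimp only
    rw [hthr, ← Nat.cast_sum]
    have hcov' : ∀ z ∈ closedBall x₀ (R₀ * ρ), ∃ i, z ∈ closedBall (c i) (ℓ * 1) := by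
      simpa only [mul_one] using hcov
    exact_mod_cast ncard_meeting_le_sum_cover c hcov' (E.X δ ω).loops (ℓ * (1 / 2)) (hfin ω)
  -- integrability of the window statistic
  have hmeasW : Measurable fun ω ↦ ({u ∈ (E.X δ ω).loops |
      (u.range ∩ closedBall x₀ (R₀ * ρ)).Nonempty ∧ ρ / 2 ^ (k + 1) ≤ diam u.range}.ncard : ℝ) :=
    measurable_from_nat.comp (BigLoops.measurable_ncard_loops_sep E hE δ _)
  have hintW : ∀ b : ℝ, Integrable (fun ω ↦ Real.exp (b * ({u ∈ (E.X δ ω).loops |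
      (u.range ∩ closedBall x₀ (R₀ * ρ)).Nonempty ∧ ρ / 2 ^ (k + 1) ≤ diam u.range}.ncard : ℝ))) E.P :=
    fun b ↦ BigLoopsMeetBall.integrable_exp_mul_ncard_loops_meeting E hE hδ x₀ (R₀ * ρ) b _
      fun _ hu ↦ hu.1
  refine ⟨hintW _, ?_⟩
  -- Hölder over the discs with equal weights
  have hord : 0 ≤ 2 * a / 8 ^ k := by positivity
  set X : Fin B → E.Ω → ℝ := fun i ω ↦ 2 * a / 8 ^ k * N i ω with hX
  obtain ⟨hIsum, hHoelder⟩ := expMoment_sum_le_prod_latticeEnsembles E hE (Fin B) Finset.univ X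
    (fun _ ↦ (B : ℝ)⁻¹) (fun _ _ ↦ by positivity)
    (by rw [Finset.sum_const, Finset.card_univ, Fintype.card_fin, nsmul_eq_mul, mul_inv_cancel₀ hB0.ne'])
    (fun i _ ↦ (hNm i).const_mul _) (fun i _ ↦ by
      simp only [hX, div_inv_eq_mul]
      have : (fun ω ↦ Real.exp (2 * a / 8 ^ k * N i ω * B)) =
          fun ω ↦ Real.exp (2 * a / 8 ^ k * B * N i ω) := by
        funext ω; ring_nf
      rw [this]
      exact hNint i _)
  -- the order per disc is bounded by `162 a R₀²`
  have hexp : 2 * a / 8 ^ k * B ≤ 162 * a * R₀ ^ 2 := by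
    have h8 : (8 : ℝ) ^ k = 2 ^ k * 4 ^ k := by rw [← mul_pow]; norm_num
    rw [h8, div_mul_eq_mul_div, div_le_iff₀ (by positivity)]
    have h2k' : (0 : ℝ) ≤ 2 ^ k - 1 := by linarith
    nlinarith [mul_le_mul_of_nonneg_left hBR (by positivity : (0 : ℝ) ≤ 2 * a),
      mul_nonneg (mul_nonneg (by positivity : (0 : ℝ) ≤ 162 * a * R₀ ^ 2) (by positivity : (0 : ℝ) ≤ 4 ^ k)) h2k']
  have hfac : ∀ i, ∫ ω, Real.exp (X i ω / (B : ℝ)⁻¹) ∂E.P ≤ C₀ := fun i ↦ by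
    simp only [hX, div_inv_eq_mul]
    calc ∫ ω, Real.exp (2 * a / 8 ^ k * N i ω * B) ∂E.P
        = ∫ ω, Real.exp (2 * a / 8 ^ k * B * N i ω) ∂E.P := by
          refine integral_congr_ae (Eventually.of_forall fun ω ↦ ?_); ring_nf
      _ ≤ ∫ ω, Real.exp (162 * a * R₀ ^ 2 * N i ω) ∂E.P :=
          integral_mono (hNint i _) (hNint i _) fun ω ↦
            Real.exp_le_exp.2 (mul_le_mul_of_nonneg_right hexp (hN0 i ω))
      _ ≤ C₀ := hK6i i
  calc ∫ ω, Real.exp (2 * a / 8 ^ k * ({u ∈ (E.X δ ω).loops |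
          (u.range ∩ closedBall x₀ (R₀ * ρ)).Nonempty ∧ ρ / 2 ^ (k + 1) ≤ diam u.range}.ncard : ℝ)) ∂E.P
      ≤ ∫ ω, Real.exp (∑ i, X i ω) ∂E.P := by
        refine integral_mono (hintW _) hIsum fun ω ↦ Real.exp_le_exp.2 ?_
        rw [hX]
        dsimp only
        rw [← Finset.mul_sum]
        exact mul_le_mul_of_nonneg_left (hdom ω) hord
    _ ≤ ∏ i, (∫ ω, Real.exp (X i ω / (B : ℝ)⁻¹) ∂E.P) ^ (B : ℝ)⁻¹ := hHoelder
    _ ≤ ∏ _i : Fin B, C₀ ^ (B : ℝ)⁻¹ :=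
        Finset.prod_le_prod (fun i _ ↦ Real.rpow_nonneg (integral_nonneg fun ω ↦ (Real.exp_pos _).le) _)
          fun i _ ↦ Real.rpow_le_rpow (integral_nonneg fun ω ↦ (Real.exp_pos _).le) (hfac i)
            (by positivity)
    _ = C₀ := by
        rw [Finset.prod_const, Finset.card_univ, Fintype.card_fin]
        exact Real.rpow_inv_natCast_pow hC₀.le hB.ne'

end UVFarBiteSq

/-! ## §3 Across scales (the registered anchor) -/

open UVFarBiteSq in
/-- **Uncentred multi-scale bound for geometrically weighted big-loop counts, both lattices**
(registered helper toward Ξ₂ `uvFarBiteSq_expMoment_latticeEnsembles`, line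
`positive-cone-weight-doubling`).  For `E ∈ latticeEnsembles`, `a ≥ 0` and `R₀ ≥ 1` there is `C > 0`
such that for every centre `x₀`, unit `ρ > 0`, mesh `δ > 0` and depth `n`,
`E_δ exp(Σ_{k<n} (a/16^k) · #{u ∈ X_δ : trace u ∩ B̄(x₀, R₀ρ) ≠ ∅, diam ≥ ρ/2^{k+1}}) ≤ C`
(integrability included) — the weighted sum `T_n` of cumulative big-loop counts dominating
`Σ_u min(1, diam(u)⁴/ρ⁴)` over the loops near the window.  Generalised Hölder across the scales with
weights `w_k = 2^{-k-1}` (`expMoment_scaleSum_le_latticeEnsembles`; `(a/16^k)/w_k = 2a/8^k`) and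
the one-scale bound `expMoment_oneScale_le` (`≤ C₀` uniformly): `C = max(1, C₀)`. -/
theorem expMoment_weightedBigLoops_le_latticeEnsembles : ∀ E ∈ latticeEnsembles, ∀ (a R₀ : ℝ), 0 ≤ a → 1 ≤ R₀ →
    ∃ C : ℝ, 0 < C ∧ ∀ (x₀ : ℂ) (ρ δ : ℝ), 0 < ρ → 0 < δ → ∀ n : ℕ,
      Integrable (fun ω ↦ Real.exp (∑ k ∈ Finset.range n, a / 16 ^ k * ({u ∈ (E.X δ ω).loops |
        (u.range ∩ Metric.closedBall x₀ (R₀ * ρ)).Nonempty ∧ ρ / 2 ^ (k + 1) ≤ Metric.diam u.range}.ncard : ℝ))) E.P ∧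
      ∫ ω, Real.exp (∑ k ∈ Finset.range n, a / 16 ^ k * ({u ∈ (E.X δ ω).loops |
        (u.range ∩ Metric.closedBall x₀ (R₀ * ρ)).Nonempty ∧ ρ / 2 ^ (k + 1) ≤ Metric.diam u.range}.ncard : ℝ)) ∂E.P ≤ C := by
  intro E hE a R₀ ha hR₀
  obtain ⟨C₀, hC₀, h1⟩ := expMoment_oneScale_le E hE a R₀ ha hR₀
  refine ⟨max 1 C₀, lt_max_of_lt_left one_pos, fun x₀ ρ δ hρ hδ n ↦ ?_⟩
  set Z : ℕ → E.Ω → ℝ := fun k ω ↦ a / 16 ^ k * ({u ∈ (E.X δ ω).loops |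
    (u.range ∩ closedBall x₀ (R₀ * ρ)).Nonempty ∧ ρ / 2 ^ (k + 1) ≤ diam u.range}.ncard : ℝ) with hZ
  set w : ℕ → ℝ := fun k ↦ 1 / 2 ^ (k + 1) with hw
  have hw0 : ∀ k, 0 < w k := fun k ↦ by positivity
  have hw1 : ∑ k ∈ Finset.range n, w k ≤ 1 := by
    have h := sum_geometric_two_le n
    have : ∑ k ∈ Finset.range n, w k = (1 / 2) * ∑ k ∈ Finset.range n, (1 / 2 : ℝ) ^ k := by
      rw [Finset.mul_sum]
      refine Finset.sum_congr rfl fun k _ ↦ ?_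
      rw [hw]; dsimp only; rw [pow_succ, one_div_pow]; ring
    rw [this]; linarith
  have hZw : ∀ k ω, Z k ω / w k = 2 * a / 8 ^ k * ({u ∈ (E.X δ ω).loops |
      (u.range ∩ closedBall x₀ (R₀ * ρ)).Nonempty ∧ ρ / 2 ^ (k + 1) ≤ diam u.range}.ncard : ℝ) := by
    intro k ω
    rw [hZ, hw]
    dsimp only
    have h16 : (16 : ℝ) ^ k = 2 ^ k * 8 ^ k := by rw [← mul_pow]; norm_num
    rw [h16, pow_succ]
    field_simp
  obtain ⟨hI, hle⟩ := expMoment_scaleSum_le_latticeEnsembles E hE n Z w (fun k ↦ w k * Real.log C₀)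
    (fun k _ ↦ (measurable_from_nat.comp (BigLoops.measurable_ncard_loops_sep E hE δ _)).const_mul _)
    (fun k _ ↦ hw0 k) hw1 (fun k _ ↦ by
      simp_rw [hZw k]
      refine ⟨(h1 x₀ ρ δ hρ hδ k).1, (h1 x₀ ρ δ hρ hδ k).2.trans (le_of_eq ?_)⟩
      rw [mul_div_cancel_left₀ _ (hw0 k).ne', Real.exp_log hC₀])
  refine ⟨hI, hle.trans ?_⟩
  rw [← Finset.sum_mul]
  rcases le_or_gt 0 (Real.log C₀) with hlog | hlog
  · calc Real.exp ((∑ k ∈ Finset.range n, w k) * Real.log C₀)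
        ≤ Real.exp (1 * Real.log C₀) := Real.exp_le_exp.2 (mul_le_mul_of_nonneg_right hw1 hlog)
      _ = C₀ := by rw [one_mul, Real.exp_log hC₀]
      _ ≤ max 1 C₀ := le_max_right _ _
  · calc Real.exp ((∑ k ∈ Finset.range n, w k) * Real.log C₀)
        ≤ Real.exp 0 := Real.exp_le_exp.2 (mul_nonpos_of_nonneg_of_nonpos
            (Finset.sum_nonneg fun k _ ↦ (hw0 k).le) hlog.le)
      _ = 1 := Real.exp_zero
      _ ≤ max 1 C₀ := le_max_left _ _

end Summit.CriticalPhenomena.CardyFormulaZ2.Cruxes.NestingRigidity.PositiveConeWeightDoubling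

end
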